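import Summits.QuantumFields.YangMills.Theorems.SqueezedSkewnessHBAmps
import Mathlib.Analysis.Distribution.SchwartzSpace.Basic

/-!
# Schwartz bumps realising lattice weights, and the real-analysis skeleton of the glue
# (route-independent support for `SqueezedSkewness.HighBallFloorsLPGlue`, stmt-QuantumFields-22797)

(1) For `s > 0` and `u ∈ ℤ⁴` a Schwartz bump `B` with `B(sv) = 1[u = v]`, `tsupport B ⊆ closedBall(su, s/4)` and
Källén–Lehmann amplitude `Σ_v B(sv) μ^{(v₀−1)⁺} e^{isp·v⃗} = μ^{(u₀−1)⁺} e^{isp·u⃗}`; supports and lattice sums of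
finite combinations `Σ_z κ_z B_z`, of sums and differences; the slab/cube containing a ball of radius `s/4` around
`s(t, a, b, c)`.  (2) `cos (2πa/S) = cos (2πb/S)` for `S ∣ a+b`, `cos (2π(m mod S)/S) = cos (2πm/S)`.  (3) The abstract
skeleton: limits of three reflection forms + polarised floor + `HasSum`s against one weight family + termwise
Källén–Lehmann bound ⟹ a floor on `Q_f`.  No definitions. [folklore]
-/

noncomputable section

open scoped BigOperators
open MeasureTheory Filter Topology Set Metric Finset Complex
open Literature.MathematicalPhysics.QuantumLattice
open Summit.QuantumFields.YangMills.Theorems.SqueezedSkewnessLatticeBumps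
open Summit.QuantumFields.YangMills.Theorems.SqueezedSkewnessHBAmps

namespace Summit.QuantumFields.YangMills.Theorems.SqueezedSkewnessHBBumps

/-! ## §1 Elementary pieces -/

/-- Vector equality `![a₀,a₁,a₂,a₃] = ![b₀,b₁,b₂,b₃]` componentwise. [folklore] -/
theorem vec4_eq_iff (a₀ a₁ a₂ a₃ b₀ b₁ b₂ b₃ : ℤ) :
    (![a₀, a₁, a₂, a₃] : Fin 4 → ℤ) = ![b₀, b₁, b₂, b₃] ↔ a₀ = b₀ ∧ a₁ = b₁ ∧ a₂ = b₂ ∧ a₃ = b₃ := by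
  constructor
  · intro h
    have h0 := congrFun h 0
    have h1 := congrFun h 1
    have h2 := congrFun h 2
    have h3 := congrFun h 3
    simp at h0 h1 h2 h3
    exact ⟨h0, h1, h2, h3⟩
  · rintro ⟨rfl, rfl, rfl, rfl⟩; rfl

/-- A limit above `c` is eventually above `c`. [folklore] -/
theorem tendsto_eventually_ge_of_lt {u : ℕ → ℝ} {l c : ℝ} (h : Tendsto u atTop (𝓝 l)) (hc : c < l) :
    ∃ k₀ : ℕ, ∀ k, k₀ ≤ k → c ≤ u k := by
  obtain ⟨k₀, hk₀⟩ := Filter.eventually_atTop.mp (h.eventually (lt_mem_nhds hc))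
  exact ⟨k₀, fun k hk => (hk₀ k hk).le⟩

/-- `a < 2^k S` eventually in `k` (`S > 0`). [folklore] -/
theorem eventually_lt_two_pow_mul (a S : ℕ) (hS : 0 < S) : ∀ᶠ k in atTop, a < 2 ^ k * S := by
  refine Filter.eventually_atTop.mpr ⟨a, fun k hk => ?_⟩
  have h1 : k < 2 ^ k := Nat.lt_two_pow_self
  have h2 : 2 ^ k ≤ 2 ^ k * S := Nat.le_mul_of_pos_right _ hS
  omega

/-- `cos (2πa/S) = cos (2πb/S)` when `S ∣ a + b`. [folklore] -/
theorem cos_dvd_add (S : ℕ) (hS : 0 < S) (a b : ℕ) (h : S ∣ a + b) :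
    Real.cos (2 * Real.pi * (a : ℝ) / S) = Real.cos (2 * Real.pi * (b : ℝ) / S) := by
  obtain ⟨n, hn⟩ := h
  have hS' : (S : ℝ) ≠ 0 := by exact_mod_cast hS.ne'
  have hb : (b : ℝ) = (S : ℝ) * n - a := by
    have := congrArg (Nat.cast : ℕ → ℝ) hn
    push_cast at this
    linarith
  have e1 : 2 * Real.pi * ((S : ℝ) * n - a) / S = 2 * Real.pi * ((S : ℝ) * n / S) - 2 * Real.pi * a / S := by ring
  rw [hb, e1, mul_div_cancel_left₀ _ hS', mul_comm (2 * Real.pi) (n : ℝ)]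
  exact (Real.cos_nat_mul_two_pi_sub _ _).symm

/-- `cos (2π (m mod S)/S) = cos (2πm/S)`. [folklore] -/
theorem cos_mod_eq (S : ℕ) (hS : 0 < S) (m : ℤ) :
    Real.cos (2 * Real.pi * (((m % (S : ℤ)).toNat : ℕ) : ℝ) / S) = Real.cos (2 * Real.pi * (m : ℝ) / S) := by
  have h0 : 0 ≤ m % (S : ℤ) := Int.emod_nonneg _ (by exact_mod_cast hS.ne')
  have hS' : (S : ℝ) ≠ 0 := by exact_mod_cast hS.ne'
  have h1 : (((m % (S : ℤ)).toNat : ℕ) : ℝ) = (m : ℝ) - (S : ℝ) * ((m / (S : ℤ) : ℤ) : ℝ) := by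
    have e1 : (((m % (S : ℤ)).toNat : ℕ) : ℤ) = m % (S : ℤ) := Int.toNat_of_nonneg h0
    have e2 : m % (S : ℤ) = m - (S : ℤ) * (m / (S : ℤ)) := Int.emod_def m S
    have e3 : (((m % (S : ℤ)).toNat : ℕ) : ℝ) = (((m % (S : ℤ) : ℤ)) : ℝ) := by exact_mod_cast e1
    rw [e3, e2]; push_cast; ring
  rw [h1, show 2 * Real.pi * ((m : ℝ) - (S : ℝ) * ((m / (S : ℤ) : ℤ) : ℝ)) / S
      = 2 * Real.pi * (m : ℝ) / S + ((-(m / (S : ℤ)) : ℤ) : ℝ) * (2 * Real.pi) by push_cast; field_simp; ring]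
  exact Real.cos_add_int_mul_two_pi _ _

/-- The centred coordinate of `Fin (2L+1)` has absolute value `≤ L`. [folklore] -/
theorem abs_cc_le (L : ℕ) (i : Fin (2 * L + 1)) :
    |(if 2 * i.val < 2 * L + 1 then (i.val : ℤ) else (i.val : ℤ) - (2 * L + 1 : ℕ))| ≤ L := by
  have hi := i.isLt
  rw [abs_le]
  by_cases h : 2 * i.val < 2 * L + 1
  · rw [if_pos h]; constructor <;> omega
  · rw [if_neg h]; push_cast; constructor <;> omega

/-! ## §2 Schwartz bumps on the scaled lattice -/

/-- Lattice sums of a compactly supported test function are finite sums, hence summable. [folklore] -/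
theorem summable_latticeSum (g : SchwartzMap (EuclideanSpace ℝ (Fin 4)) ℝ) {s : ℝ} (hs : 0 < s)
    (hg : HasCompactSupport (g : EuclideanSpace ℝ (Fin 4) → ℝ)) (a : (Fin 4 → ℤ) → ℝ) (w : (Fin 4 → ℤ) → ℂ) :
    Summable (fun x : Fin 4 → ℤ => (((g (s • siteToE (d := 4) x) * a x : ℝ)) : ℂ) * w x) := by
  obtain ⟨R, hR⟩ := hg.isCompact.isBounded.subset_closedBall (0 : EuclideanSpace ℝ (Fin 4))
  refine summable_of_hasFiniteSupport
    ((Set.Finite.pi (fun _ : Fin 4 => Set.finite_Icc (-⌈R / s⌉) ⌈R / s⌉)).subset ?_)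
  intro x hx
  rw [Function.mem_support] at hx
  have hgx : g (s • siteToE (d := 4) x) ≠ 0 := by
    intro h0; apply hx; simp [h0]
  rw [Set.mem_univ_pi]
  intro i
  have hball := hR (subset_tsupport _ hgx)
  rw [Metric.mem_closedBall, dist_zero_right] at hball
  have hi : ‖(s • siteToE (d := 4) x) i‖ ≤ ‖s • siteToE (d := 4) x‖ := PiLp.norm_apply_le _ i
  have hcoord : (s • siteToE (d := 4) x) i = s * (x i : ℝ) := by simp [siteToE_apply]
  rw [hcoord, Real.norm_eq_abs, abs_mul, abs_of_pos hs] at hi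
  have habs : |(x i : ℝ)| ≤ R / s := by
    rw [le_div_iff₀ hs, mul_comm]; exact hi.trans hball
  obtain ⟨h1, h2⟩ := abs_le.mp habs
  have hceil := Int.le_ceil (R / s)
  constructor
  · have : ((-⌈R / s⌉ : ℤ) : ℝ) ≤ x i := by push_cast; linarith
    exact_mod_cast this
  · have : (x i : ℝ) ≤ ((⌈R / s⌉ : ℤ) : ℝ) := h2.trans hceil
    exact_mod_cast this

/-- Lattice sums are additive in the test function. [folklore] -/
theorem latticeSum_add (g h : SchwartzMap (EuclideanSpace ℝ (Fin 4)) ℝ) {s : ℝ} (hs : 0 < s)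
    (hg : HasCompactSupport (g : EuclideanSpace ℝ (Fin 4) → ℝ)) (hh : HasCompactSupport (h : EuclideanSpace ℝ (Fin 4) → ℝ))
    (a : (Fin 4 → ℤ) → ℝ) (w : (Fin 4 → ℤ) → ℂ) :
    ∑' x : Fin 4 → ℤ, ((((g + h) (s • siteToE (d := 4) x) * a x : ℝ)) : ℂ) * w x
      = ∑' x : Fin 4 → ℤ, (((g (s • siteToE (d := 4) x) * a x : ℝ)) : ℂ) * w x
        + ∑' x : Fin 4 → ℤ, (((h (s • siteToE (d := 4) x) * a x : ℝ)) : ℂ) * w x := by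
  rw [← Summable.tsum_add (summable_latticeSum g hs hg a w) (summable_latticeSum h hs hh a w)]
  refine tsum_congr fun x => ?_
  rw [add_apply]; push_cast; ring

/-- Lattice sums are subtractive in the test function. [folklore] -/
theorem latticeSum_sub (g h : SchwartzMap (EuclideanSpace ℝ (Fin 4)) ℝ) {s : ℝ} (hs : 0 < s)
    (hg : HasCompactSupport (g : EuclideanSpace ℝ (Fin 4) → ℝ)) (hh : HasCompactSupport (h : EuclideanSpace ℝ (Fin 4) → ℝ))
    (a : (Fin 4 → ℤ) → ℝ) (w : (Fin 4 → ℤ) → ℂ) :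
    ∑' x : Fin 4 → ℤ, ((((g - h) (s • siteToE (d := 4) x) * a x : ℝ)) : ℂ) * w x
      = ∑' x : Fin 4 → ℤ, (((g (s • siteToE (d := 4) x) * a x : ℝ)) : ℂ) * w x
        - ∑' x : Fin 4 → ℤ, (((h (s • siteToE (d := 4) x) * a x : ℝ)) : ℂ) * w x := by
  rw [← Summable.tsum_sub (summable_latticeSum g hs hg a w) (summable_latticeSum h hs hh a w)]
  refine tsum_congr fun x => ?_
  rw [sub_apply]; push_cast; ring

/-- Evaluation of a finite combination of Schwartz maps. [folklore] -/
theorem sum_smul_apply {ι : Type*} [Fintype ι] (κ : ι → ℝ) (B : ι → SchwartzMap (EuclideanSpace ℝ (Fin 4)) ℝ)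
    (y : EuclideanSpace ℝ (Fin 4)) : (∑ z, κ z • B z) y = ∑ z, κ z * B z y := by
  rw [_root_.sum_apply]
  simp only [smul_apply, smul_eq_mul]

/-- The support of a finite combination sits in the union of the supports. [folklore] -/
theorem tsupport_sum_smul_subset {ι : Type*} [Fintype ι] (κ : ι → ℝ)
    (B : ι → SchwartzMap (EuclideanSpace ℝ (Fin 4)) ℝ) :
    tsupport ((∑ z, κ z • B z : SchwartzMap _ ℝ) : EuclideanSpace ℝ (Fin 4) → ℝ)
      ⊆ ⋃ z, tsupport (B z : EuclideanSpace ℝ (Fin 4) → ℝ) := by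
  refine closure_minimal ?_ (isClosed_iUnion_of_finite fun z => isClosed_tsupport _)
  intro y hy
  rw [Function.mem_support, sum_smul_apply] at hy
  obtain ⟨z, -, hz⟩ := Finset.exists_ne_zero_of_sum_ne_zero hy
  exact Set.mem_iUnion.mpr ⟨z, subset_tsupport _ (Function.mem_support.mpr (right_ne_zero_of_mul hz))⟩

/-- A finite combination of compactly supported Schwartz maps is compactly supported. [folklore] -/
theorem hasCompactSupport_sum_smul {ι : Type*} [Fintype ι] (κ : ι → ℝ)
    (B : ι → SchwartzMap (EuclideanSpace ℝ (Fin 4)) ℝ) (hB : ∀ z, HasCompactSupport (B z : EuclideanSpace ℝ (Fin 4) → ℝ)) :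
    HasCompactSupport ((∑ z, κ z • B z : SchwartzMap _ ℝ) : EuclideanSpace ℝ (Fin 4) → ℝ) :=
  (isCompact_iUnion fun z => (hB z).isCompact).of_isClosed_subset (isClosed_tsupport _)
    (tsupport_sum_smul_subset κ B)

/-- Lattice sums of a finite combination. [folklore] -/
theorem latticeSum_sum_smul {ι : Type*} [Fintype ι] (κ : ι → ℝ) (B : ι → SchwartzMap (EuclideanSpace ℝ (Fin 4)) ℝ)
    {s : ℝ} (hs : 0 < s) (hB : ∀ z, HasCompactSupport (B z : EuclideanSpace ℝ (Fin 4) → ℝ))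
    (a : (Fin 4 → ℤ) → ℝ) (w : (Fin 4 → ℤ) → ℂ) :
    ∑' x : Fin 4 → ℤ, ((((∑ z, κ z • B z : SchwartzMap _ ℝ) (s • siteToE (d := 4) x) * a x : ℝ)) : ℂ) * w x
      = ∑ z, (κ z : ℂ) * ∑' x : Fin 4 → ℤ, (((B z (s • siteToE (d := 4) x) * a x : ℝ)) : ℂ) * w x := by
  have hterm : ∀ x : Fin 4 → ℤ,
      ((((∑ z, κ z • B z : SchwartzMap _ ℝ) (s • siteToE (d := 4) x) * a x : ℝ)) : ℂ) * w x
        = ∑ z, (κ z : ℂ) * ((((B z (s • siteToE (d := 4) x) * a x : ℝ)) : ℂ) * w x) := by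
    intro x
    rw [sum_smul_apply]
    push_cast
    rw [Finset.sum_mul, Finset.sum_mul]
    refine Finset.sum_congr rfl fun z _ => ?_
    ring
  rw [tsum_congr hterm, Summable.tsum_finsetSum (fun z _ => (summable_latticeSum (B z) hs (hB z) a w).mul_left _)]
  refine Finset.sum_congr rfl fun z _ => ?_
  rw [tsum_mul_left]

/-- `tsupport (φ + ψ) ⊆ tsupport φ ∪ tsupport ψ` for Schwartz maps. [folklore] -/
theorem tsupport_add_subset' (φ ψ : SchwartzMap (EuclideanSpace ℝ (Fin 4)) ℝ) :
    tsupport ((φ + ψ : SchwartzMap _ ℝ) : EuclideanSpace ℝ (Fin 4) → ℝ)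
      ⊆ tsupport (φ : EuclideanSpace ℝ (Fin 4) → ℝ) ∪ tsupport (ψ : EuclideanSpace ℝ (Fin 4) → ℝ) := by
  rw [show ((φ + ψ : SchwartzMap _ ℝ) : EuclideanSpace ℝ (Fin 4) → ℝ) = fun y => φ y + ψ y from
    funext fun y => add_apply φ ψ y]
  exact tsupport_add _ _

/-- `tsupport (φ − ψ) ⊆ tsupport φ ∪ tsupport ψ` for Schwartz maps. [folklore] -/
theorem tsupport_sub_subset' (φ ψ : SchwartzMap (EuclideanSpace ℝ (Fin 4)) ℝ) :
    tsupport ((φ - ψ : SchwartzMap _ ℝ) : EuclideanSpace ℝ (Fin 4) → ℝ)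
      ⊆ tsupport (φ : EuclideanSpace ℝ (Fin 4) → ℝ) ∪ tsupport (ψ : EuclideanSpace ℝ (Fin 4) → ℝ) := by
  rw [show ((φ - ψ : SchwartzMap _ ℝ) : EuclideanSpace ℝ (Fin 4) → ℝ) = fun y => φ y - ψ y from
    funext fun y => sub_apply φ ψ y, tsupport, tsupport, tsupport, ← closure_union]
  exact closure_mono (Function.support_sub _ _)

/-- **A Schwartz bump at a lattice point**: radius `s/4` around `s·u`; it reads `1[u = v]` at `s·v`, and its
Källén–Lehmann amplitude is the single term at the centre. [folklore] -/
theorem exists_bump {s : ℝ} (hs : 0 < s) (u : Fin 4 → ℤ) :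
    ∃ B : SchwartzMap (EuclideanSpace ℝ (Fin 4)) ℝ,
      HasCompactSupport (B : EuclideanSpace ℝ (Fin 4) → ℝ) ∧
      tsupport (B : EuclideanSpace ℝ (Fin 4) → ℝ) ⊆ Metric.closedBall (s • siteToE (d := 4) u) (s / 4) ∧
      (∀ v : Fin 4 → ℤ, B (s • siteToE (d := 4) v) = if u = v then 1 else 0) ∧
      ∀ (μ : ℝ) (p : Fin 3 → ℝ),
        ∑' v : Fin 4 → ℤ, (((B (s • siteToE (d := 4) v) * μ ^ (Int.toNat (v 0 - 1))) : ℝ) : ℂ)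
            * cexp (I * ((s * ∑ k : Fin 3, p k * (v k.succ : ℝ) : ℝ) : ℂ))
          = ((μ ^ (Int.toNat (u 0 - 1)) : ℝ) : ℂ) * cexp (I * ((s * ∑ k : Fin 3, p k * (u k.succ : ℝ) : ℝ) : ℂ)) := by
  let φ : ContDiffBump (s • siteToE (d := 4) u) := ⟨s / 8, s / 4, by positivity, by linarith⟩
  have hφ : φ.rOut ≤ s / 2 := by show s / 4 ≤ s / 2; linarith
  have hcoe : ∀ y, (φ.hasCompactSupport.toSchwartzMap φ.contDiff : SchwartzMap _ ℝ) y
      = (φ : EuclideanSpace ℝ (Fin 4) → ℝ) y := fun y => HasCompactSupport.toSchwartzMap_toFun _ _ y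
  have hcoe' : ((φ.hasCompactSupport.toSchwartzMap φ.contDiff : SchwartzMap _ ℝ) : EuclideanSpace ℝ (Fin 4) → ℝ)
      = (φ : EuclideanSpace ℝ (Fin 4) → ℝ) := funext hcoe
  refine ⟨φ.hasCompactSupport.toSchwartzMap φ.contDiff, ?_, ?_, ?_, ?_⟩
  · rw [hcoe']; exact φ.hasCompactSupport
  · rw [hcoe', φ.tsupport_eq]
  · intro v; rw [hcoe]; exact bump_smul_siteToE hs u v φ hφ
  · intro μ p; simp only [hcoe]; exact amp_bump hs u φ hφ μ p

/-- Points of the ball of radius `s/4` around `s·(t, a, b, c)` (`t ≥ 1`, `|a|,|b|,|c| ≤ L`) have height in `(0, s(t+1)]`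
and spatial coordinates `< s(L + ½)` in absolute value. [folklore] -/
theorem slab_cube {s : ℝ} (hs : 0 < s) (L t : ℕ) (ht : 1 ≤ t) (a b c : ℤ) (ha : |a| ≤ L) (hb : |b| ≤ L)
    (hc : |c| ≤ L) {y : EuclideanSpace ℝ (Fin 4)}
    (hy : y ∈ Metric.closedBall (s • siteToE (d := 4) ![(t : ℤ), a, b, c]) (s / 4)) :
    (0 < y 0 ∧ y 0 ≤ s * (t + 1)) ∧ ∀ i : Fin 3, |y i.succ| < s * (L + 1 / 2) := by
  rw [Metric.mem_closedBall] at hy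
  have hco : ∀ j : Fin 4, |y j - s * ((![(t : ℤ), a, b, c] : Fin 4 → ℤ) j : ℝ)| ≤ s / 4 := by
    intro j
    have h := PiLp.dist_apply_le y (s • siteToE (d := 4) ![(t : ℤ), a, b, c]) j
    have h2 : (s • siteToE (d := 4) ![(t : ℤ), a, b, c]) j = s * ((![(t : ℤ), a, b, c] : Fin 4 → ℤ) j : ℝ) := by
      simp [siteToE_apply]
    rw [h2, Real.dist_eq] at h
    exact h.trans hy
  have hvec : ∀ i : Fin 3, |(((![(t : ℤ), a, b, c] : Fin 4 → ℤ) i.succ : ℤ) : ℝ)| ≤ L := by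
    have ha' : |(a : ℝ)| ≤ L := by rw [← Int.cast_abs]; exact_mod_cast ha
    have hb' : |(b : ℝ)| ≤ L := by rw [← Int.cast_abs]; exact_mod_cast hb
    have hc' : |(c : ℝ)| ≤ L := by rw [← Int.cast_abs]; exact_mod_cast hc
    intro i
    fin_cases i
    · simpa using ha'
    · simpa using hb'
    · simpa using hc'
  have ht' : (1 : ℝ) ≤ t := by exact_mod_cast ht
  refine ⟨?_, fun i => ?_⟩
  · have h0 := hco 0
    have e0 : (((![(t : ℤ), a, b, c] : Fin 4 → ℤ) 0 : ℤ) : ℝ) = t := by simp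
    rw [e0] at h0
    obtain ⟨h0a, h0b⟩ := abs_le.mp h0
    have hst : s * 1 ≤ s * t := mul_le_mul_of_nonneg_left ht' hs.le
    constructor <;> nlinarith
  · have h1 := hco i.succ
    have h2 := hvec i
    have h3 := abs_sub_abs_le_abs_sub (y i.succ) (s * ((![(t : ℤ), a, b, c] : Fin 4 → ℤ) i.succ : ℝ))
    rw [abs_mul, abs_of_pos hs] at h3
    have h4 : s * |(((![(t : ℤ), a, b, c] : Fin 4 → ℤ) i.succ : ℤ) : ℝ)| ≤ s * L :=
      mul_le_mul_of_nonneg_left h2 hs.le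
    nlinarith

/-- A test function supported in `closedBall(2e₀, ½)` lives in the height slab `(0, 5/2]` and, once `sL ≥ 1`, in the open
spatial cube of half-width `s(L + ½)`. [folklore] -/
theorem slab_of_ball_two (f : EuclideanSpace ℝ (Fin 4) → ℝ) {s : ℝ} {L : ℕ} (hs : 0 < s) (h1sL : 1 ≤ s * L)
    (hfball : tsupport f ⊆ Metric.closedBall (EuclideanSpace.single (0 : Fin 4) (2 : ℝ)) (1 / 2)) :
    tsupport f ⊆ {y | 0 < y 0 ∧ y 0 ≤ 5 / 2} ∧ tsupport f ⊆ {y | ∀ i : Fin 3, |y i.succ| < s * (L + 1 / 2)} := by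
  constructor
  · intro y hy
    have hd := hfball hy
    rw [Metric.mem_closedBall] at hd
    have hc : dist (y 0) ((EuclideanSpace.single (0 : Fin 4) (2 : ℝ)) 0)
        ≤ dist y (EuclideanSpace.single (0 : Fin 4) (2 : ℝ)) := PiLp.dist_apply_le _ _ 0
    have h0 : (EuclideanSpace.single (0 : Fin 4) (2 : ℝ)) 0 = 2 := by simp
    rw [h0, Real.dist_eq] at hc
    obtain ⟨h1, h2⟩ := abs_le.mp (hc.trans hd)
    simp only [Set.mem_setOf_eq]
    constructor <;> linarith
  · intro y hy
    simp only [Set.mem_setOf_eq]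
    intro i
    have hd := hfball hy
    rw [Metric.mem_closedBall] at hd
    have hc : dist (y i.succ) ((EuclideanSpace.single (0 : Fin 4) (2 : ℝ)) i.succ)
        ≤ dist y (EuclideanSpace.single (0 : Fin 4) (2 : ℝ)) := PiLp.dist_apply_le _ _ i.succ
    have h0 : (EuclideanSpace.single (0 : Fin 4) (2 : ℝ)) i.succ = 0 := by simp [Fin.succ_ne_zero]
    rw [h0, Real.dist_eq, sub_zero] at hc
    have : s * ((L : ℝ) + 1 / 2) = s * L + s / 2 := by ring
    linarith

/-! ## §3 The real-analysis skeleton of the glue -/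

/-- Limits `Q₊, Q₋` of two reflection forms, the polarised floor `4M_k = Q₊ₖ − Q₋ₖ`, `e ≤ M_k` eventually, `HasSum`s
against one weight family `W ≥ 0` with `A₊ₙ − A₋ₙ = 4Dₙ` and the termwise bound `½ Dₙ σ² ≤ A_fₙ`, give
`½ c² e ≤ Q_f` for `0 < c ≤ σ`, `0 ≤ e`. [folklore] -/
theorem glue_abstract {QP QM Mk W AF AP AM D : ℕ → ℝ} {Qf Qp Qm e σ c : ℝ}
    (hQP : Tendsto QP atTop (𝓝 Qp)) (hQM : Tendsto QM atTop (𝓝 Qm))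
    (hpol : ∀ᶠ k in atTop, 4 * Mk k = QP k - QM k) (hfl : ∀ᶠ k in atTop, e ≤ Mk k)
    (hSF : HasSum (fun n => W n * AF n) Qf) (hSP : HasSum (fun n => W n * AP n) Qp)
    (hSM : HasSum (fun n => W n * AM n) Qm) (hW : ∀ n, 0 ≤ W n)
    (hD : ∀ n, AP n - AM n = 4 * D n) (hKL : ∀ n, 1 / 2 * D n * σ ^ 2 ≤ AF n)
    (he : 0 ≤ e) (hc : 0 < c) (hσ : c ≤ σ) : 1 / 2 * c ^ 2 * e ≤ Qf := by
  have hM : Tendsto Mk atTop (𝓝 ((Qp - Qm) / 4)) := by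
    have h4 : Tendsto (fun k => (QP k - QM k) / 4) atTop (𝓝 ((Qp - Qm) / 4)) := (hQP.sub hQM).div_const 4
    refine h4.congr' ?_
    filter_upwards [hpol] with k hk
    linarith
  have heM : e ≤ (Qp - Qm) / 4 := ge_of_tendsto hM hfl
  have hSD : HasSum (fun n => W n * D n) ((Qp - Qm) / 4) := by
    have h := (hSP.sub hSM).div_const 4
    have hfun : (fun n => W n * D n) = fun n => (W n * AP n - W n * AM n) / 4 := by
      funext n; rw [← mul_sub, hD]; ring
    rw [hfun]; exact h
  have hQf : 1 / 2 * σ ^ 2 * ((Qp - Qm) / 4) ≤ Qf := by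
    refine hasSum_le (fun n => ?_) (hSD.mul_left (1 / 2 * σ ^ 2)) hSF
    calc 1 / 2 * σ ^ 2 * (W n * D n) = W n * (1 / 2 * D n * σ ^ 2) := by ring
      _ ≤ W n * AF n := mul_le_mul_of_nonneg_left (hKL n) (hW n)
  have hσ2 : c ^ 2 ≤ σ ^ 2 := pow_le_pow_left₀ hc.le hσ 2
  calc 1 / 2 * c ^ 2 * e ≤ 1 / 2 * σ ^ 2 * e := by nlinarith
    _ ≤ 1 / 2 * σ ^ 2 * ((Qp - Qm) / 4) := mul_le_mul_of_nonneg_left heM (by positivity)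
    _ ≤ Qf := hQf

end Summit.QuantumFields.YangMills.Theorems.SqueezedSkewnessHBBumps

end
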